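import Literature.MathematicalPhysics.QuantumFieldTheory.BalabanImbrieJaffe1984to88.BIJ88Eq536Linearization
import Literature.MathematicalPhysics.QuantumFieldTheory.BalabanImbrieJaffe1984to88.BIJ85Eq453GaugeField

/-!
# `BalabanImbrieJaffe1984to88.BIJ88Eq532Torus` — T. Bałaban, J. Imbrie, A. Jaffe, *Effective action and cluster properties of the abelian
Higgs model*, Commun. Math. Phys. **114** (1988) 257–315 [BalabanImbrieJaffe1988], **(5.3.2)** p. 280: the plaquette field `f^{(k)}` after
the first gauge-field translation (5.3.1) `u = u′(Λ₁^{(k)*}Q^{s*}v)` — ON THE TORUS CARRIER OF RECORD (kind «model instance»), together with the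
BRIDGE between the two group-valued surface fields of the tree: r18 gen 4's `BIJ85BlockAveragesTorus.surfFactor` (the factor of the
substitution (3.9)/(3.24)) IS seat p31 gen 3's `BIJ85Eq453GaugeField.qsstarG` = [BalabanImbrieJaffe1985] **(4.5.2)–(4.5.3)** `Q^{s*}` on
group-valued fields (one object, two files; nothing re-declared).

statement-level skeleton of published theorems with citation tags; proofs where landed; nothing here is a claim about the Yang–Mills mass gap

PDF held: `paper:balaban1988-cmp114-bij-abelian-higgs-effective-action` (journal page = PDF page + 256), p. 280 [PDF 24] read as the image
`HOME/lit-balaban-r16/renders/cmp114/original-p024-x2.png`; [BalabanImbrieJaffe1985] (`paper:balaban1985-cmp97-bij-higgs-minimizers`,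
journal page = PDF + 298) p. 304 [PDF 6] (Fig. 1, (2.15)) and p. 312 [PDF 14] ((4.5.2)–(4.5.3)) read earlier by this seat (gen 3).

CITATION HEADER (lean-in-tree rule).  Part of the lit-balaban TYPED SKELETON (HOME `run/shared/lean/pub/lit-balaban/`), PHASE-2 proof
seat p31 gen 5 (unit `lit-balaban-p31-g5`; TAKING line HOME/STATUS.md 2026-08-21T06:4xZ; file 3 of the gen after `BIJ88Eq536Linearization`
p252131 ((5.3.6)–(5.3.7) constraint sets) and `BIJ88Eq537Jacobian` p252614 (the Jacobian `du_b = (e_k/2π)dA_b`)).  WHAT IS REPRODUCED: row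
`C2.Eq5.3.1-5.3.7` of `HOME/lit-balaban-r16/ROWS-C2-part2.md` (owner r16), member **(5.3.2)** (absent before this file).

THE PRINTED TEXT (verbatim, p. 280 [PDF 24]): *"As in (3.24) we put u = u′(Λ₁^{(k)*}Q^{s*}v), (5.3.1) … Let us define f(p) = (ie_k)^{−1}
log v(p). … Under the translation we have f^{(k)}(p) = Λ₁^{(k)**c}(ie_k)^{−1} log u′(p)v(p′₀) + Λ₁^{(k)**}(∂A′ + L^{−2}Q^{e*}f)(p), (5.3.2)
where p₀ is the portion of p intersecting some B^s(b′), b′ ∈ Λ₁^{(k)′*}, and p′₀ is formed by replacing each bond in p₀ with the block bond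
b′ in Λ₁^{(k)′*}, whose B^s(b′) contains it."*  (`f^{(k)}(p) = (ie_k)^{−1} log u(p)`, p. 274.)

CARRIERS (all of record).  Torus `Balaban1983to89.Site P j` (standing range `j + 1 ≤ m + K`), `U(1) = BIJ88Sect3Statements.U1` read in `ℂ`
by `toC`, plaquette variables `GaugeField.plaqHol` (`Setup`) / `BIJ88Sect3Statements.plaqVar ∘ cfg`, the logarithm `(ie_k)^{−1} log` =
`BIJ88Sect3Statements.fieldStrength e_k` (principal branch, as in r16's `SmallF`), the translation (5.3.1) = `surfMul u′ (cutoff Λ v)`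
(r18's substitution with the coarse cut-off `Λ = Λ₁^{(k)′*}` of `BIJ88Eq536Linearization.cutoff`), `u′ = e^{ie_kA′}` =
`BIJ88Eq536Linearization.phaseField`, the edge plaquettes `B^e(p′)` and `Q^{e*}` ((2.21)–(2.22)) = seat p31 gen 2's
`BIJ85CurlQsstar.torusEdgeCells` (`.B`, `.Qstar`), the surface bonds `B^s(b′)` (2.15) = gen 1's `BIJ85Eq219Proof.torusBlockBonds` (`.Bs`).
READING of `v(p′₀)`: for `p ∈ B^e(p′)` the bonds of `p₀` are the surface bonds of `∂p`, replaced by their block bonds they form `∂p′`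
restricted to `Λ₁′*`; the cut-off field `cutoff Λ v` is `v` on `Λ` and `1` off it, so `v(p′₀) = plaqHol (cutoff Λ v) p′` EXACTLY (bonds of
`∂p′` outside the cut-off contribute `1`); for `p` in no `B^e(p′)` the portion `p₀` is empty or consists of two opposite surface bonds of
one `B^s(b′)` and `v(p′₀) = 1`.

WHAT IS PROVED (theorems only; 0 `sorry`, standard axioms, no `Prop`-valued fact introduced).
* §1 THE BRIDGE: `isCross_iff_blockOf_ne` (r18's *"crossing"* = gen 3's *"not interior"*), **`surfFactor_eq_qsstarG`** (`surfFactor w =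
  qsstarG w` as group-valued fields on `T^{(j)}`), `surfMul_apply_qsstarG` (`(u′·Q^{s*}w)_b = u′_b(Q^{s*}w)_b`), `mem_Bs_coarse_of_isCross` /
  `isCross_of_mem_Bs` (r18's `IsCross`/`coarse` ↔ gen 1's corridor `B^s(·)` of `torusBlockBonds`).
* §2 PLAQUETTES OF THE TRANSLATED FIELD (abelian): `toC_plaqHol_surfMul` (`u(∂p) = u′(∂p)·(Q^{s*}w)(∂p)` in `ℂ`),
  **`plaqHol_surfMul_of_mem`** (`p ∈ B^e(p′)`: `u(∂p) = u′(∂p)·w(∂p′)`, by gen 3's any-group plaquette identity `plaqHol_qsstarG_of_mem`),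
  **`plaqHol_surfMul_of_not_mem`** (`p` in no `B^e(p′)`: `u(∂p) = u′(∂p)`); the cut-off plaquette variable `plaqHol_cutoff_of_mem` (all four
  block bonds in `Λ`: `= v(∂p′)`) and `plaqHol_cutoff_of_not_mem` (none in `Λ`: `= 1`).
* §3 **(5.3.2)**: `eq532_outside` (for EVERY `p ∈ B^e(p′)`: `(ie_k)^{−1} log u(p) = (ie_k)^{−1} log[u′(p)·v(p′₀)]`, `v(p′₀) = plaqHol (cutoff Λ v)
  p′`), `eq532_outside_of_not_mem` (`p` in no `B^e(p′)`: `= (ie_k)^{−1} log u′(p)`), and INSIDE the cut-off, for `u′ = e^{ie_kA′}`, `e_k ≠ 0`: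
  **`eq532_inside_of_mem`** (`p ∈ B^e(p′)`, `∂p′ ⊂ Λ₁′*`, `|e_k((∂A′)(p) + f(p′))| < π`: `f^{(k)}(p) = (∂A′)(p) + L^{−2}(Q^{e*}f)(p)` with
  `(Q^{e*}f)(p) = L²f(p′)`) and **`eq532_inside_of_not_mem`** (`p` in no `B^e(p′)`, `|e_k(∂A′)(p)| < π`: `f^{(k)}(p) = (∂A′)(p) = (∂A′ +
  L^{−2}Q^{e*}f)(p)`, `Q^{e*}f = 0` there) — the two cases of the printed `Λ₁^{(k)**}(∂A′ + L^{−2}Q^{e*}f)(p)`.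
Imports: this seat's `BIJ88Eq536Linearization` (→ r18's `BIJ85BlockAveragesTorus`, r18's `BIJ88Sect3Translations`) and gen 3's
`BIJ85Eq453GaugeField` (→ gen 1/2's `BIJ85Eq219Proof`, `BIJ85CurlQsstar`); standard axioms.
-/

namespace Literature.MathematicalPhysics.QuantumFieldTheory.BalabanImbrieJaffe1984to88.BIJ88Eq532Torus

open Literature.MathematicalPhysics.QuantumFieldTheory.Balaban1983to89
open BIJ88Sect3Statements (U1 toC toC_mul toC_one cfg plaqVar plaqVar_cfg fieldStrength)
open BIJ88Sect3Rescaling (toC_injective_U1)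
open BIJ85Sect1Model (argB)
open BIJ85BlockAveragesTorus (expU1 toC_expU1 toC_inv' exp_argB_toC IsCross coarse surfFactor surfMul blockOf_tgt_of_isCross
  blockOf_tgt_of_not_isCross)
open BIJ85Eq453GaugeField (qsstarG qsstarG_apply plaqHol_qsstarG_of_mem plaqHol_qsstarG_of_not_mem eq_of_mem_Bs mem_Bs_of_not_interior)
open BIJ85CurlQsstar (torusEdgeCells)
open BIJ85Eq219Proof (torusBlockBonds)
open BIJ88Eq536Linearization (phaseField toC_phaseField toC_phaseField_eq_phase cutoff cutoff_of_mem cutoff_of_not_mem)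
open BIJ88Sect3Translations (phase plaqVar_phase fieldStrength_exp_of_small)
open GaugeField (plaqHol)
open scoped BigOperators Real
open Complex Finset

noncomputable section

variable {P : Params} {j : ℕ}

/-! ## §1 The bridge: r18's surface factor (3.9)/(3.24) IS the group-valued `Q^{s*}` (4.5.2)–(4.5.3) of gen 3 -/

/-- kernel: `y + e_μ ≠ y` on every torus of the series. [folklore] -/
private theorem shift_ne_self {k : ℕ} (y : Balaban1983to89.Site P k) (μ : Fin P.d) : y.shift μ ≠ y := by
  intro h
  have h1 := congrFun h μ
  simp only [Balaban1983to89.Site.shift, Function.update_self] at h1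
  exact one_ne_zero (add_eq_left.1 h1)

/-- kernel: r18's *"b crosses a block face"* (`IsCross b`: `b₋` at position `L − 1` in the direction of `b`) is gen 3's *"b is not interior"*
(`blockOf b₊ ≠ blockOf b₋`) — (2.15) *"b₋ ∈ B(b′₋), b₊ ∈ B(b′₊)"* (standing range). [cite: BalabanImbrieJaffe1985, (2.15) p.304] -/
theorem isCross_iff_blockOf_ne (hj : j + 1 ≤ P.m + P.K) (b : PBond P j) : IsCross b ↔ blockOf b.tgt ≠ blockOf b.src := by
  constructor
  · intro h
    rw [blockOf_tgt_of_isCross hj h]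
    exact shift_ne_self _ _
  · intro h
    by_contra hc
    exact h (blockOf_tgt_of_not_isCross hj hc)

/-- **One object, two files: r18's surface factor of (3.9)/(3.24) IS the group-valued pull-back `Q^{s*}` of (4.5.2)–(4.5.3)** (gen 3's
`qsstarG`: `V⟨blockOf b₋, μ⟩` on the corridor bonds, `1` inside blocks) — as fields on `T^{(j)}` (standing range).
[cite: BalabanImbrieJaffe1985, (4.5.3) p.312] -/
theorem surfFactor_eq_qsstarG (hj : j + 1 ≤ P.m + P.K) (w : GaugeField P (j + 1) U1) : surfFactor w = qsstarG w := by
  funext b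
  rw [qsstarG_apply]
  unfold surfFactor
  by_cases hb : IsCross b
  · rw [if_pos hb, if_neg ((isCross_iff_blockOf_ne hj b).1 hb)]
    rfl
  · rw [if_neg hb, if_pos (blockOf_tgt_of_not_isCross hj hb)]

/-- **(3.24)/(5.3.1) bondwise with (4.5.2): `(u′·Q^{s*}w)_b = u′_b·(Q^{s*}w)_b`** — r18's `surfMul` through gen 3's `qsstarG` (standing range).
[cite: BalabanImbrieJaffe1988, (5.3.1) p.280] -/
theorem surfMul_apply_qsstarG (hj : j + 1 ≤ P.m + P.K) (u' : GaugeField P j U1) (w : GaugeField P (j + 1) U1) (b : PBond P j) :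
    surfMul u' w b = u' b * qsstarG w b := by
  show u' b * surfFactor w b = _
  rw [surfFactor_eq_qsstarG hj]

/-- kernel: a crossing bond lies in the corridor `B^s(b′)` of its block bond `b′ = coarse b` (gen 1's `torusBlockBonds`; standing range).
[cite: BalabanImbrieJaffe1985, (2.15) p.304] -/
theorem mem_Bs_coarse_of_isCross (hj : j + 1 ≤ P.m + P.K) {b : PBond P j} (hb : IsCross b) :
    b ∈ (torusBlockBonds P j).Bs (coarse b) :=
  mem_Bs_of_not_interior hj ((isCross_iff_blockOf_ne hj b).1 hb)

/-- kernel: conversely a corridor bond `b ∈ B^s(c)` crosses, and `c` is its block bond (standing range). [cite: BalabanImbrieJaffe1985, (2.15) p.304] -/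
theorem isCross_of_mem_Bs (hj : j + 1 ≤ P.m + P.K) {b : PBond P j} {c : PBond P (j + 1)} (h : b ∈ (torusBlockBonds P j).Bs c) :
    IsCross b ∧ c = coarse b := by
  obtain ⟨hc, hne⟩ := eq_of_mem_Bs hj h
  exact ⟨(isCross_iff_blockOf_ne hj b).2 hne, hc⟩

/-! ## §2 Plaquette variables of the translated field `u = u′·(Q^{s*}w)` (abelian) -/

/-- kernel: **`u(∂p) = u′(∂p)·(Q^{s*}w)(∂p)`** read in `ℂ` (the group `U(1)` is commutative there). [cite: BalabanImbrieJaffe1988, (5.3.2) p.280] -/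
theorem toC_plaqHol_surfMul (hj : j + 1 ≤ P.m + P.K) (u' : GaugeField P j U1) (w : GaugeField P (j + 1) U1) (p : Balaban1983to89.Plaq P j) :
    toC (plaqHol (surfMul u' w) p) = toC (plaqHol u' p) * toC (plaqHol (qsstarG w) p) := by
  simp only [GaugeField.plaqHol, surfMul_apply_qsstarG hj, toC_mul, toC_inv', mul_inv]
  ring

/-- **On an edge plaquette `p ∈ B^e(p′)`: `u(∂p) = u′(∂p)·w(∂p′)`** — the surface field contributes the COARSE plaquette variable of `w`
(gen 3's any-group identity `(Q^{s*}w)(∂p) = w(∂p′)`; standing range, `2 ≤ d`). [cite: BalabanImbrieJaffe1988, (5.3.2) p.280] -/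
theorem plaqHol_surfMul_of_mem (hj : j + 1 ≤ P.m + P.K) (hd : 2 ≤ P.d) (u' : GaugeField P j U1) (w : GaugeField P (j + 1) U1)
    {p : Balaban1983to89.Plaq P j} {p' : Balaban1983to89.Plaq P (j + 1)} (h : p ∈ (torusEdgeCells P j hd).B p') :
    plaqHol (surfMul u' w) p = plaqHol u' p * plaqHol w p' := by
  apply toC_injective_U1
  rw [toC_plaqHol_surfMul hj, plaqHol_qsstarG_of_mem hj hd w h, toC_mul]

/-- **On a plaquette in no `B^e(p′)` (interior and face plaquettes): `u(∂p) = u′(∂p)`** — the two surface bonds of a face plaquette carry the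
same `w_{b′}` with opposite orientations (gen 3's `(Q^{s*}w)(∂p) = 1`; standing range, `2 ≤ d`). [cite: BalabanImbrieJaffe1988, (5.3.2) p.280] -/
theorem plaqHol_surfMul_of_not_mem (hj : j + 1 ≤ P.m + P.K) (hd : 2 ≤ P.d) (u' : GaugeField P j U1) (w : GaugeField P (j + 1) U1)
    {p : Balaban1983to89.Plaq P j} (h : ∀ p', p ∉ (torusEdgeCells P j hd).B p') :
    plaqHol (surfMul u' w) p = plaqHol u' p := by
  apply toC_injective_U1
  rw [toC_plaqHol_surfMul hj, plaqHol_qsstarG_of_not_mem hj hd w h, toC_one, mul_one]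

/-- **The cut-off plaquette variable inside `Λ₁′**`**: if all four block bonds of `∂p′` lie in the cut-off `Λ`, `(cut-off·v)(∂p′) = v(∂p′)`.
[cite: BalabanImbrieJaffe1988, (5.3.2) p.280] -/
theorem plaqHol_cutoff_of_mem {Λ : Finset (PBond P (j + 1))} (v : GaugeField P (j + 1) U1) {p' : Balaban1983to89.Plaq P (j + 1)}
    (h1 : (⟨p'.src, p'.μ⟩ : PBond P (j + 1)) ∈ Λ) (h2 : (⟨p'.src.shift p'.μ, p'.ν⟩ : PBond P (j + 1)) ∈ Λ)
    (h3 : (⟨p'.src.shift p'.ν, p'.μ⟩ : PBond P (j + 1)) ∈ Λ) (h4 : (⟨p'.src, p'.ν⟩ : PBond P (j + 1)) ∈ Λ) :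
    plaqHol (cutoff Λ v) p' = plaqHol v p' := by
  simp only [GaugeField.plaqHol, cutoff_of_mem v h1, cutoff_of_mem v h2, cutoff_of_mem v h3, cutoff_of_mem v h4]

/-- … and far outside: if no block bond of `∂p′` lies in `Λ`, `(cut-off·v)(∂p′) = 1`. [cite: BalabanImbrieJaffe1988, (5.3.2) p.280] -/
theorem plaqHol_cutoff_of_not_mem {Λ : Finset (PBond P (j + 1))} (v : GaugeField P (j + 1) U1) {p' : Balaban1983to89.Plaq P (j + 1)}
    (h1 : (⟨p'.src, p'.μ⟩ : PBond P (j + 1)) ∉ Λ) (h2 : (⟨p'.src.shift p'.μ, p'.ν⟩ : PBond P (j + 1)) ∉ Λ)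
    (h3 : (⟨p'.src.shift p'.ν, p'.μ⟩ : PBond P (j + 1)) ∉ Λ) (h4 : (⟨p'.src, p'.ν⟩ : PBond P (j + 1)) ∉ Λ) :
    plaqHol (cutoff Λ v) p' = 1 := by
  simp only [GaugeField.plaqHol, cutoff_of_not_mem v h1, cutoff_of_not_mem v h2, cutoff_of_not_mem v h3, cutoff_of_not_mem v h4,
    inv_one, mul_one]

/-! ## §3 (5.3.2): the plaquette field `f^{(k)}(p) = (ie_k)^{−1} log u(p)` after the translation -/

/-- **(5.3.2), the `Λ₁^{(k)**c}` clause, on EVERY edge plaquette**: for `u = u′·(Λ₁′*-cut-off·Q^{s*}v)` and `p ∈ B^e(p′)`,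
`(ie_k)^{−1} log u(p) = (ie_k)^{−1} log[u′(p)·v(p′₀)]` with `v(p′₀) = (cut-off·v)(∂p′)` (the block bonds of `∂p′` outside `Λ₁′*` contributing
`1`) — exact, for every branch value. [cite: BalabanImbrieJaffe1988, (5.3.2) p.280] -/
theorem eq532_outside (hj : j + 1 ≤ P.m + P.K) (hd : 2 ≤ P.d) (ek : ℝ) (u' : GaugeField P j U1) (Λ : Finset (PBond P (j + 1)))
    (v : GaugeField P (j + 1) U1) {p : Balaban1983to89.Plaq P j} {p' : Balaban1983to89.Plaq P (j + 1)} (h : p ∈ (torusEdgeCells P j hd).B p') :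
    fieldStrength ek (toC (plaqHol (surfMul u' (cutoff Λ v)) p)) =
      fieldStrength ek (toC (plaqHol u' p) * toC (plaqHol (cutoff Λ v) p')) := by
  rw [plaqHol_surfMul_of_mem hj hd u' (cutoff Λ v) h, toC_mul]

/-- **(5.3.2), the `Λ₁^{(k)**c}` clause, on the other plaquettes**: for `p` in no `B^e(p′)` the portion `p₀` contributes nothing,
`(ie_k)^{−1} log u(p) = (ie_k)^{−1} log u′(p)`. [cite: BalabanImbrieJaffe1988, (5.3.2) p.280] -/
theorem eq532_outside_of_not_mem (hj : j + 1 ≤ P.m + P.K) (hd : 2 ≤ P.d) (ek : ℝ) (u' : GaugeField P j U1)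
    (Λ : Finset (PBond P (j + 1))) (v : GaugeField P (j + 1) U1) {p : Balaban1983to89.Plaq P j} (h : ∀ p', p ∉ (torusEdgeCells P j hd).B p') :
    fieldStrength ek (toC (plaqHol (surfMul u' (cutoff Λ v)) p)) = fieldStrength ek (toC (plaqHol u' p)) := by
  rw [plaqHol_surfMul_of_not_mem hj hd u' (cutoff Λ v) h]

/-- kernel: C2's reading `cfg` of the field `e^{ie_kA′}` is r18's `phase e_k A′`. [cite: BalabanImbrieJaffe1988, (5.3.1) p.280] -/
theorem cfg_phaseField (ek : ℝ) (A' : PBond P j → ℝ) : cfg (phaseField fun b => ek * A' b) = phase ek A' := by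
  funext b
  exact toC_phaseField_eq_phase ek A' b

/-- kernel: **`u′(∂p) = e^{ie_k(∂A′)(p)}`** for `u′ = e^{ie_kA′}` (`∂` = the unit-lattice curl `LatticeFieldCalculus.curl 1`).
[cite: BalabanImbrieJaffe1988, (5.3.2) p.280] -/
theorem toC_plaqHol_phaseField (ek : ℝ) (A' : PBond P j → ℝ) (p : Balaban1983to89.Plaq P j) :
    toC (plaqHol (phaseField fun b => ek * A' b) p) = Complex.exp (I * ((ek * LatticeFieldCalculus.curl 1 A' p : ℝ) : ℂ)) := by
  rw [← plaqVar_cfg, cfg_phaseField, plaqVar_phase]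

/-- kernel: **`v(∂p′) = e^{ie_kf(p′)}`** with `f(p′) := (1/e_k)·argB v(∂p′)` the real plaquette field of `v` in the branch (2.11) (p. 280
*"f(p) = (ie_k)^{−1} log v(p)"*; `e_k ≠ 0`). [cite: BalabanImbrieJaffe1988, (5.3.1) p.280] -/
theorem toC_plaqHol_eq_exp_argB {ek : ℝ} (hek : ek ≠ 0) (v : GaugeField P (j + 1) U1) (p' : Balaban1983to89.Plaq P (j + 1)) :
    toC (plaqHol v p') = Complex.exp (I * ((ek * (argB (toC (plaqHol v p')) / ek) : ℝ) : ℂ)) := by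
  have hc : ek * (argB (toC (plaqHol v p')) / ek) = argB (toC (plaqHol v p')) := by field_simp
  rw [hc, mul_comm I, exp_argB_toC]

/-- **(5.3.2), the `Λ₁^{(k)**}` clause, on an edge plaquette**: for `u′ = e^{ie_kA′}` (`e_k ≠ 0`), `p ∈ B^e(p′)` with all four block bonds
of `∂p′` in the cut-off `Λ₁′*`, and the small-field (principal-branch) hypothesis `|e_k((∂A′)(p) + f(p′))| < π`:
**`f^{(k)}(p) = (ie_k)^{−1} log u(p) = (∂A′)(p) + L^{−2}(Q^{e*}f)(p)`**, `Q^{e*}` = (2.22) (gen 2's `torusEdgeCells.Qstar`: `(Q^{e*}f)(p) = L²f(p′)`),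
`f(p′) = (1/e_k)argB v(∂p′)` (standing range, `2 ≤ d`). [cite: BalabanImbrieJaffe1988, (5.3.2) p.280] -/
theorem eq532_inside_of_mem (hj : j + 1 ≤ P.m + P.K) (hd : 2 ≤ P.d) {ek : ℝ} (hek : ek ≠ 0) (A' : PBond P j → ℝ)
    {Λ : Finset (PBond P (j + 1))} (v : GaugeField P (j + 1) U1) {p : Balaban1983to89.Plaq P j} {p' : Balaban1983to89.Plaq P (j + 1)}
    (h : p ∈ (torusEdgeCells P j hd).B p')
    (h1 : (⟨p'.src, p'.μ⟩ : PBond P (j + 1)) ∈ Λ) (h2 : (⟨p'.src.shift p'.μ, p'.ν⟩ : PBond P (j + 1)) ∈ Λ)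
    (h3 : (⟨p'.src.shift p'.ν, p'.μ⟩ : PBond P (j + 1)) ∈ Λ) (h4 : (⟨p'.src, p'.ν⟩ : PBond P (j + 1)) ∈ Λ)
    (hsmall : |ek * (LatticeFieldCalculus.curl 1 A' p + argB (toC (plaqHol v p')) / ek)| < π) :
    fieldStrength ek (toC (plaqHol (surfMul (phaseField fun b => ek * A' b) (cutoff Λ v)) p)) =
      ((LatticeFieldCalculus.curl 1 A' p + (P.L : ℝ) ^ (-(2 : ℤ)) *
        (torusEdgeCells P j hd).Qstar (fun q => argB (toC (plaqHol v q)) / ek) p : ℝ) : ℂ) := by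
  have hL : (P.L : ℝ) ≠ 0 := Nat.cast_ne_zero.mpr P.L_pos.ne'
  have hQ : (torusEdgeCells P j hd).Qstar (fun q => argB (toC (plaqHol v q)) / ek) p =
      (P.L : ℝ) ^ 2 * (argB (toC (plaqHol v p')) / ek) := (torusEdgeCells P j hd).Qstar_of_mem _ h
  have hcancel : (P.L : ℝ) ^ (-(2 : ℤ)) * ((P.L : ℝ) ^ 2 * (argB (toC (plaqHol v p')) / ek)) = argB (toC (plaqHol v p')) / ek := by
    rw [zpow_neg, zpow_ofNat, ← mul_assoc, inv_mul_cancel₀ (pow_ne_zero 2 hL), one_mul]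
  have harg : I * ((ek * LatticeFieldCalculus.curl 1 A' p : ℝ) : ℂ) + I * ((ek * (argB (toC (plaqHol v p')) / ek) : ℝ) : ℂ) =
      I * ((ek * (LatticeFieldCalculus.curl 1 A' p + argB (toC (plaqHol v p')) / ek) : ℝ) : ℂ) := by
    push_cast
    ring
  have hplaq : toC (plaqHol (surfMul (phaseField fun b => ek * A' b) (cutoff Λ v)) p) =
      Complex.exp (I * ((ek * (LatticeFieldCalculus.curl 1 A' p + argB (toC (plaqHol v p')) / ek) : ℝ) : ℂ)) := by
    rw [plaqHol_surfMul_of_mem hj hd _ (cutoff Λ v) h, plaqHol_cutoff_of_mem v h1 h2 h3 h4, toC_mul, toC_plaqHol_phaseField]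
    conv_lhs => rw [toC_plaqHol_eq_exp_argB hek v p']
    rw [← Complex.exp_add, harg]
  rw [hQ, hcancel, hplaq, fieldStrength_exp_of_small hek hsmall]

/-- **(5.3.2), the `Λ₁^{(k)**}` clause, on the other plaquettes**: for `u′ = e^{ie_kA′}` (`e_k ≠ 0`) and `p` in no `B^e(p′)`, under
`|e_k(∂A′)(p)| < π`: **`f^{(k)}(p) = (∂A′)(p) = (∂A′ + L^{−2}Q^{e*}f)(p)`** (`Q^{e*}f = 0` off the edge plaquettes, (2.22)).
[cite: BalabanImbrieJaffe1988, (5.3.2) p.280] -/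
theorem eq532_inside_of_not_mem (hj : j + 1 ≤ P.m + P.K) (hd : 2 ≤ P.d) {ek : ℝ} (hek : ek ≠ 0) (A' : PBond P j → ℝ)
    (Λ : Finset (PBond P (j + 1))) (v : GaugeField P (j + 1) U1) {p : Balaban1983to89.Plaq P j} (h : ∀ p', p ∉ (torusEdgeCells P j hd).B p')
    (hsmall : |ek * LatticeFieldCalculus.curl 1 A' p| < π) :
    fieldStrength ek (toC (plaqHol (surfMul (phaseField fun b => ek * A' b) (cutoff Λ v)) p)) =
      ((LatticeFieldCalculus.curl 1 A' p + (P.L : ℝ) ^ (-(2 : ℤ)) *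
        (torusEdgeCells P j hd).Qstar (fun q => argB (toC (plaqHol v q)) / ek) p : ℝ) : ℂ) := by
  rw [(torusEdgeCells P j hd).Qstar_of_not_mem _ h, mul_zero, add_zero, plaqHol_surfMul_of_not_mem hj hd _ (cutoff Λ v) h,
    toC_plaqHol_phaseField, fieldStrength_exp_of_small hek hsmall]

end

end Literature.MathematicalPhysics.QuantumFieldTheory.BalabanImbrieJaffe1984to88.BIJ88Eq532Torus
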